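import Mathlib
import HarnessLib
import Summits.NavierStokesRegularity.NavierStokesRegularity.Theorems.TaylorModelRungThreeCertificateReadoutVStep

/-!
# Crux K1b-DR (stmt-NavierStokesRegularity-23954), line `taylor-model` — v3 read-outs, K-SIDE part 4-W: the WINDOWED
# read-out step `readoutStepWin : ROInWin → ROOutWin` (ns-tm-g4 g6, owner of the read-out layer)

Why (finding of 2026-08-28T22:45Z, stage 34 of the v4/v5 data): the landed `readoutStep` (part 4) evaluates the crossing
objects of the last sub-step over the WHOLE sub-step `u ∈ [0, h_{S−1}]` — `TP := coreTP x ⟨0,h⟩`, `Y0/Y1 := inStepY TP …`,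
`Min := inStepM … h` — exactly what (R6)/(R10) of `ReadoutsV` demand.  With an emitted last sub-step of ordinary length
(`h = 6.4·10⁻⁴`, centre speed `|ẏ(i₀,1)| ≈ 4·10²`) the base box `Y0` contains the centre's whole arc, `≈ 10⁶` polytope radii
long at level 0, so (R9)/(R11) cannot pass; and the level-1 crossing spread (`≈ 10⁻¹⁰`) forbids shrinking the sub-step
below what level 0 needs (`≈ 4·10⁻¹²`).  The cure is to evaluate every crossing object over an emitted CROSSING WINDOW inside
the last sub-step, SEPARATELY per level:

* level 1 (all polytope trajectories): `u ∈ [u1lo, u1hi]`; level 0 (the centre trajectory alone): `u ∈ [u0lo, u0hi]`, nested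
  `0 ≤ u1lo ≤ u0lo ≤ u0hi ≤ u1hi ≤ h` (four emitted dyadics per stage — `ROInWin` = `ROIn` + the window);
* `MinW` — the in-step kernel box over `u ∈ [u1lo, u1hi]` (`stepMatrixMF` at the `u`-box `⟨u1lo,u1hi⟩`, remainder scale over
  `[0, u1hi]`); `TPw U` — the centre Taylor polynomial over a `u`-box `U`; `Zl U uR Hl` — the in-step state box over `U` with
  remainder scale `J·[0,uR]^(p+1)` and hull `Hl` (the landed `inStepY` with `TP := TPw U`, `h := uR`, `Min := MinW`);
* `Z1 := Zl ⟨u1lo,u1hi⟩ u1hi H1`, `Z0 := Zl ⟨u0lo,u0hi⟩ u0hi H0` (the WINDOWED in-step boxes), and the four ENDPOINT boxes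
  `Z1a/Z1b/Z0a/Z0b` at `u = u1lo, u1hi, u0lo, u0hi`;  `VBw := MinW·(Vc ⊕ B·[Z])`;  `Fw := qBboxMA(Z1, Z1)`;
* `readoutStepWin`: `ok :=` window order test `winOK` ∧ (R5) at the nodes (unchanged) ∧ (R7) on the FAT box `Y1` of part 4
  (strict monotonicity of the section value over the whole last sub-step — the G-side locates the crossing) ∧ the WINDOW-END
  SECTION TESTS `testR5 Wσ LB Z1a Z1b`, `testR5 Wσ LB Z0a Z0b` (before at `u?lo`, after at `u?hi`, per level) ∧ (R8) on `Z1` ∧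
  `landOK Z0` ∧ (R9) on `landBox Z0` ∧ (R11) on `Z1` with `Fw`, `VBw`.

Every test is a landed kernel (`testR5/testR7/testR8/landOK/testR9/testR11`, parts 1–3b) re-pointed at the windowed boxes; the
only new arithmetic is `winOK` (five `Dyad.ble`).  Soundness corollaries per clause: `…ReadoutVStepWinSound`; the semantic
clauses they discharge: `TaylorModelV.ReadoutsVW` (`…VReadoutsWinDefs`).  This file also proves the window analogues of part 2's
`inStepM_spec` / `inStepM_kernel` / `inStepM_memMat` for `MinW` (`u ∈ [u1lo,u1hi]`).

HONEST FRAMING: kernel bookkeeping for the MODEL certificate №23954 (rung TL-M3); nothing here is a statement about the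
Navier–Stokes equations.
-/

-- the sub-problem namespace repeats the summit name by design (D-0017)
set_option linter.dupNamespace false

namespace Summit.NavierStokesRegularity.NavierStokesRegularity.Theorems.TaylorModelCert

open scoped BigOperators
open Set
open Literature.Analysis.FluidPDE.TaoCascade Literature.Analysis.FluidPDE.TaoCascade.TaylorChain
open Summit.NavierStokesRegularity.NavierStokesRegularity.Theorems.TaylorModelReadout (varJet)
open Summit.NavierStokesRegularity.NavierStokesRegularity.Theorems.TaylorModelV (basisSt)

/-- **Windowed read-out step INPUT**: the part-4 input `base : ROIn` and the crossing windows of the last sub-step —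
level 1 `[u1lo, u1hi]` (all polytope trajectories cross inside), level 0 `[u0lo, u0hi]` (the centre trajectory crosses
inside), offsets from `Tn (S−1)`. [folklore] -/
structure ROInWin where
  base : ROIn
  (u0lo u0hi u1lo u1hi : Dyad)

/-- **Windowed read-out step OUTPUT**: verdict, the fat level-1 box `Y1` (for (R6)/(R7)), the windowed boxes `Z0`, `Z1`,
and the windowed derivative kernel box `VB`. [folklore] -/
structure ROOutWin where
  ok : Bool
  (Y0 Y1 Z0 Z1 : Array IntervalD)
  VB : Array (Array IntervalD)

namespace CertTables

section Defs

variable {K : Type} [Field K]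

/-- **In-step kernel enclosure over a `u`-WINDOW** `[ulo, uhi]` of a sub-step: the (M) matrix `stepMatrixMF` over the hull
box `H2` at the `u`-box `⟨ulo, uhi⟩`, remainder scales `JU·[0,uhi]^(pV+1)`. [folklore] -/
def inStepMW (T : CertTables K) (coefB : Fin 4 → Fin 4 → Fin 4 → ℕ → ℤ → IntervalD) (prec pV : ℕ) (H2 : Array IntervalD)
    (ulo uhi : Dyad) (JU : Array Dyad) (ωinvB : Array IntervalD) : Array (Array IntervalD) :=
  T.stepMatrixMF coefB prec H2 pV ⟨ulo, uhi⟩ (T.inStepS prec pV JU uhi) ωinvB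

/-- **Window order test**: `0 ≤ u1lo ≤ u0lo ≤ u0hi ≤ u1hi ≤ h`. [folklore] -/
def winOK (u0lo u0hi u1lo u1hi h : Dyad) : Bool :=
  Dyad.ble (Dyad.ofInt 0) u1lo && Dyad.ble u1lo u0lo && Dyad.ble u0lo u0hi && Dyad.ble u0hi u1hi && Dyad.ble u1hi h

end Defs

end CertTables

namespace ROInWin

variable {K : Type} [Field K] (T : CertTables K) (rw : ROInWin)

/-- Windowed in-step kernel box (level-1 window). [folklore] -/
def MinW : Array (Array IntervalD) :=
  T.inStepMW rw.base.coefB rw.base.prec rw.base.pV rw.base.H2 rw.u1lo rw.u1hi rw.base.JU rw.base.ωinvB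

/-- Centre Taylor polynomial over a `u`-box `U`. [folklore] -/
def TPw (U : IntervalD) : Array IntervalD := T.coreTP rw.base.coefB rw.base.mt rw.base.prec rw.base.p rw.base.x U

/-- In-step state box over the `u`-box `U`, remainder scale `J·[0,uR]^(p+1)`, hull `Hl`, kernels `MinW`. [folklore] -/
def Zl (U : IntervalD) (uR : Dyad) (Hl : Array IntervalD) : Array IntervalD :=
  T.inStepY rw.base.prec rw.base.p (rw.TPw T U) rw.base.J uR (rw.MinW T) Hl rw.base.x

/-- Windowed level-1 box. [folklore] -/
def Z1 : Array IntervalD := rw.Zl T ⟨rw.u1lo, rw.u1hi⟩ rw.u1hi rw.base.H1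
/-- Windowed level-0 box. [folklore] -/
def Z0 : Array IntervalD := rw.Zl T ⟨rw.u0lo, rw.u0hi⟩ rw.u0hi rw.base.H0
/-- Level-1 endpoint box at `u1lo`. [folklore] -/
def Z1a : Array IntervalD := rw.Zl T ⟨rw.u1lo, rw.u1lo⟩ rw.u1lo rw.base.H1
/-- Level-1 endpoint box at `u1hi`. [folklore] -/
def Z1b : Array IntervalD := rw.Zl T ⟨rw.u1hi, rw.u1hi⟩ rw.u1hi rw.base.H1
/-- Level-0 endpoint box at `u0lo`. [folklore] -/
def Z0a : Array IntervalD := rw.Zl T ⟨rw.u0lo, rw.u0lo⟩ rw.u0lo rw.base.H0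
/-- Level-0 endpoint box at `u0hi`. [folklore] -/
def Z0b : Array IntervalD := rw.Zl T ⟨rw.u0hi, rw.u0hi⟩ rw.u0hi rw.base.H0

/-- Windowed derivative kernel box `MinW · (Vc ⊕ B·[Z])`. [folklore] -/
def VBw : Array (Array IntervalD) :=
  mulII T.n rw.base.prec (rw.MinW T)
    (addIM T.n rw.base.prec (IntervalD.pointIM T.n rw.base.Vc) (mulDI T.n rw.base.prec rw.base.B rw.base.Z))

/-- Field box over the windowed level-1 box. [folklore] -/
def Fw : Array IntervalD := T.qBboxMA rw.base.coefB rw.base.prec rw.base.mt (rw.Z1 T) (rw.Z1 T)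

end ROInWin

namespace CertTables

variable {K : Type} [Field K]

/-- **The WINDOWED read-out step** (one stage, last sub-step; see the module docstring). [folklore] -/
def readoutStepWin (T : CertTables K) (rw : ROInWin) : ROOutWin :=
  let ri := rw.base
  { ok := winOK rw.u0lo rw.u0hi rw.u1lo rw.u1hi ri.h &&
          T.testR5 ri.prec ri.Wσ ri.LB ri.H1 ri.Ha1 && T.testR7 ri.coefB ri.prec ri.mt ri.Wσ ri.GB (ri.Y1 T) &&
          T.testR5 ri.prec ri.Wσ ri.LB (rw.Z1a T) (rw.Z1b T) && T.testR5 ri.prec ri.Wσ ri.LB (rw.Z0a T) (rw.Z0b T) &&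
          T.testR8 ri.ASB ri.AK ri.rlo (rw.Z1 T) && T.landOK (rw.Z0 T) &&
          T.testR9 ri.prec ri.nF ri.WJ (T.landBox ri.prec ri.LvB ri.tv (rw.Z0 T)) ri.ctrB ri.βB ri.sB ri.radB &&
          T.testR11 ri.prec ri.nF ri.WJ ri.G ri.rPB ri.βB ri.ρ ri.LvB ri.tv (rw.Z1 T) ri.Wσ (rw.Fw T) (rw.VBw T)
    Y0 := ri.Y0 T, Y1 := ri.Y1 T, Z0 := rw.Z0 T, Z1 := rw.Z1 T, VB := rw.VBw T }

variable (T : CertTables K) (rw : ROInWin)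

omit [Field K] in
/-- [folklore] -/ theorem readoutStepWin_Y0 : (T.readoutStepWin rw).Y0 = rw.base.Y0 T := rfl
omit [Field K] in
/-- [folklore] -/ theorem readoutStepWin_Y1 : (T.readoutStepWin rw).Y1 = rw.base.Y1 T := rfl
omit [Field K] in
/-- [folklore] -/ theorem readoutStepWin_Z0 : (T.readoutStepWin rw).Z0 = rw.Z0 T := rfl
omit [Field K] in
/-- [folklore] -/ theorem readoutStepWin_Z1 : (T.readoutStepWin rw).Z1 = rw.Z1 T := rfl
omit [Field K] in
/-- [folklore] -/ theorem readoutStepWin_VB : (T.readoutStepWin rw).VB = rw.VBw T := rfl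

omit [Field K] in
/-- The verdict unfolds to the nine tests. [folklore] -/
theorem readoutStepWin_ok (h : (T.readoutStepWin rw).ok = true) :
    winOK rw.u0lo rw.u0hi rw.u1lo rw.u1hi rw.base.h = true ∧
    T.testR5 rw.base.prec rw.base.Wσ rw.base.LB rw.base.H1 rw.base.Ha1 = true ∧
    T.testR7 rw.base.coefB rw.base.prec rw.base.mt rw.base.Wσ rw.base.GB (rw.base.Y1 T) = true ∧
    T.testR5 rw.base.prec rw.base.Wσ rw.base.LB (rw.Z1a T) (rw.Z1b T) = true ∧
    T.testR5 rw.base.prec rw.base.Wσ rw.base.LB (rw.Z0a T) (rw.Z0b T) = true ∧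
    T.testR8 rw.base.ASB rw.base.AK rw.base.rlo (rw.Z1 T) = true ∧ T.landOK (rw.Z0 T) = true ∧
    T.testR9 rw.base.prec rw.base.nF rw.base.WJ (T.landBox rw.base.prec rw.base.LvB rw.base.tv (rw.Z0 T))
      rw.base.ctrB rw.base.βB rw.base.sB rw.base.radB = true ∧
    T.testR11 rw.base.prec rw.base.nF rw.base.WJ rw.base.G rw.base.rPB rw.base.βB rw.base.ρ rw.base.LvB rw.base.tv
      (rw.Z1 T) rw.base.Wσ (rw.Fw T) (rw.VBw T) = true := by
  have h' : (winOK rw.u0lo rw.u0hi rw.u1lo rw.u1hi rw.base.h &&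
      T.testR5 rw.base.prec rw.base.Wσ rw.base.LB rw.base.H1 rw.base.Ha1 &&
      T.testR7 rw.base.coefB rw.base.prec rw.base.mt rw.base.Wσ rw.base.GB (rw.base.Y1 T) &&
      T.testR5 rw.base.prec rw.base.Wσ rw.base.LB (rw.Z1a T) (rw.Z1b T) &&
      T.testR5 rw.base.prec rw.base.Wσ rw.base.LB (rw.Z0a T) (rw.Z0b T) &&
      T.testR8 rw.base.ASB rw.base.AK rw.base.rlo (rw.Z1 T) && T.landOK (rw.Z0 T) &&
      T.testR9 rw.base.prec rw.base.nF rw.base.WJ (T.landBox rw.base.prec rw.base.LvB rw.base.tv (rw.Z0 T))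
        rw.base.ctrB rw.base.βB rw.base.sB rw.base.radB &&
      T.testR11 rw.base.prec rw.base.nF rw.base.WJ rw.base.G rw.base.rPB rw.base.βB rw.base.ρ rw.base.LvB rw.base.tv
        (rw.Z1 T) rw.base.Wσ (rw.Fw T) (rw.VBw T)) = true := h
  simp only [Bool.and_eq_true] at h'
  obtain ⟨⟨⟨⟨⟨⟨⟨⟨hw, h5⟩, h7⟩, h5a⟩, h5b⟩, h8⟩, hL⟩, h9⟩, h11⟩ := h'
  exact ⟨hw, h5, h7, h5a, h5b, h8, hL, h9, h11⟩

omit [Field K] in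
/-- **Soundness of the window order test** (reals). [folklore] -/
theorem winOK_sound {u0lo u0hi u1lo u1hi h : Dyad} (hw : winOK u0lo u0hi u1lo u1hi h = true) :
    0 ≤ u1lo.toReal ∧ u1lo.toReal ≤ u0lo.toReal ∧ u0lo.toReal ≤ u0hi.toReal ∧ u0hi.toReal ≤ u1hi.toReal ∧
      u1hi.toReal ≤ h.toReal := by
  simp only [winOK, Bool.and_eq_true, Dyad.ble_iff] at hw
  obtain ⟨⟨⟨⟨h1, h2⟩, h3⟩, h4⟩, h5⟩ := hw
  have h0 : (Dyad.ofInt 0).toReal = 0 := by simp [Dyad.toReal_ofInt]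
  rw [h0] at h1
  exact ⟨h1, h2, h3, h4, h5⟩

omit [Field K] in
/-- [folklore] -/
theorem size_Zl (U : IntervalD) (uR : Dyad) (Hl : Array IntervalD) : (rw.Zl T U uR Hl).size = T.n := by
  simp only [ROInWin.Zl, inStepY, Array.size_ofFn]

omit [Field K] in
/-- [folklore] -/
theorem size_Z1 : (rw.Z1 T).size = T.n := T.size_Zl rw _ _ _

omit [Field K] in
/-- [folklore] -/
theorem size_Z0 : (rw.Z0 T).size = T.n := T.size_Zl rw _ _ _

/-! ### The windowed in-step kernel box encloses every in-step kernel at `u ∈ [ulo, uhi]` -/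

variable {φ : K →+* ℝ} {coefB : Fin 4 → Fin 4 → Fin 4 → ℕ → ℤ → IntervalD}

/-- **`inStepMW` encloses polynomial ± remainder scale** for every `ζ` of the hull box and every `u ∈ [ulo, uhi]` with
`0 ≤ u` (window analogue of `inStepM_spec`). [folklore] -/
theorem inStepMW_spec (hco : T.CoefOK φ) (hcB : CoefBoxOK φ T coefB) (prec pV : ℕ) {H2 : Array IntervalD} (hH2 : H2.size = T.n)
    {ζ : Fin 4 → ℤ → ℝ} (hζ : MemVec T.n (T.wv ζ) H2) {ulo uhi : Dyad} {u : ℝ} (hu0 : 0 ≤ u) (hulo : ulo.toReal ≤ u)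
    (huhi : u ≤ uhi.toReal) (JU : Array Dyad)
    {ω : ℤ → ℝ} {ωinvB : Array IntervalD} (hω : ∀ i k, -T.Kb ≤ k → k ≤ T.Ka → IntervalD.mem ((ω k)⁻¹) (IntervalD.aget ωinvB (T.idx i k)))
    (i : Fin 4) {k : ℤ} (hk1 : -T.Kb ≤ k) (hk2 : k ≤ T.Ka) (i' : Fin 4) {k' : ℤ} (hk1' : -T.Kb ≤ k') (hk2' : k' ≤ T.Ka) :
    (imget (T.inStepMW coefB prec pV H2 ulo uhi JU ωinvB) (T.idx i' k') (T.idx i k)).lo.toReal ≤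
        (∑ n ∈ Finset.range (pV + 1), varJet (T.toCertData φ).Qb ζ (basisSt i k) n i' k' * u ^ n) -
          vre JU (T.idx i' k') * (ω k)⁻¹ * u ^ (pV + 1) ∧
      (∑ n ∈ Finset.range (pV + 1), varJet (T.toCertData φ).Qb ζ (basisSt i k) n i' k' * u ^ n) +
          vre JU (T.idx i' k') * (ω k)⁻¹ * u ^ (pV + 1) ≤
        (imget (T.inStepMW coefB prec pV H2 ulo uhi JU ωinvB) (T.idx i' k') (T.idx i k)).hi.toReal := by
  have hU : IntervalD.mem u ⟨ulo, uhi⟩ := ⟨hulo, huhi⟩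
  have hU0 : IntervalD.mem u ⟨Dyad.ofInt 0, uhi⟩ := IntervalD.mem_zeroTo hu0 huhi
  have hS : ∀ i' k', -T.Kb ≤ k' → k' ≤ T.Ka →
      IntervalD.mem ((fun i' k' => vre JU (T.idx i' k')) i' k' * u ^ (pV + 1)) (IntervalD.aget (T.inStepS prec pV JU uhi) (T.idx i' k')) := by
    intro i' k' h1 h2
    have hc : T.idx i' k' < T.n := T.idx_lt_n i' ⟨h1, h2⟩
    unfold inStepS; rw [IntervalD.aget_ofFn _ hc]
    exact IntervalD.mem_mulR prec (IntervalD.mem_ofDyad _) (IntervalD.mem_powR prec hU0 _)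
  exact T.stepMatrixMF_spec hco hcB prec pV hH2 hζ hU hS hω i hk1 hk2 i' hk1' hk2'

/-- **Every in-step kernel at `u ∈ [ulo, uhi]` lies in `inStepMW`** (window analogue of `inStepM_kernel`). [folklore] -/
theorem inStepMW_kernel (hco : T.CoefOK φ) (hcB : CoefBoxOK φ T coefB) (prec pV : ℕ) {H2 : Array IntervalD} (hH2 : H2.size = T.n)
    {ulo uhi : Dyad} {u : ℝ} (hu0 : 0 ≤ u) (hulo : ulo.toReal ≤ u) (huhi : u ≤ uhi.toReal) (JU : Array Dyad)
    {ω : ℤ → ℝ} {ωinvB : Array IntervalD} (hω : ∀ i k, -T.Kb ≤ k → k ≤ T.Ka → IntervalD.mem ((ω k)⁻¹) (IntervalD.aget ωinvB (T.idx i k)))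
    {A : Fin 4 → ℤ → Fin 4 → ℤ → ℝ}
    (hA : ∀ i' k', -T.Kb ≤ k' → k' ≤ T.Ka → ∀ i k, -T.Kb ≤ k → k ≤ T.Ka →
      ∃ ζ : Fin 4 → ℤ → ℝ, T.InBoxW (T.vecF (IntervalD.loR H2)) (T.vecF (IntervalD.hiR H2)) ζ ∧
        |A i' k' i k - ∑ n ∈ Finset.range (pV + 1), varJet (T.toCertData φ).Qb ζ (basisSt i k) n i' k' * u ^ n|
          ≤ T.vecF (vre JU) i' k' * (ω k)⁻¹ * u ^ (pV + 1))
    (i' : Fin 4) {k' : ℤ} (hk1' : -T.Kb ≤ k') (hk2' : k' ≤ T.Ka) (i : Fin 4) {k : ℤ} (hk1 : -T.Kb ≤ k) (hk2 : k ≤ T.Ka) :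
    (imget (T.inStepMW coefB prec pV H2 ulo uhi JU ωinvB) (T.idx i' k') (T.idx i k)).lo.toReal ≤ A i' k' i k ∧
      A i' k' i k ≤ (imget (T.inStepMW coefB prec pV H2 ulo uhi JU ωinvB) (T.idx i' k') (T.idx i k)).hi.toReal := by
  obtain ⟨ζ, hζB, hAζ⟩ := hA i' k' hk1' hk2' i k hk1 hk2
  have hζ : MemVec T.n (T.wv ζ) H2 := T.mem_of_inBoxW_loR hζB
  have hM := T.inStepMW_spec hco hcB prec pV hH2 hζ hu0 hulo huhi JU hω i hk1 hk2 i' hk1' hk2'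
  rw [T.vecF_apply, if_pos ⟨hk1', hk2'⟩] at hAζ
  have h1 := (abs_le.1 hAζ).1
  have h2 := (abs_le.1 hAζ).2
  constructor <;> linarith [hM.1, hM.2]

/-- **Coordinate form**: an in-step kernel at `u ∈ [ulo, uhi]` lies in `inStepMW` as a coordinate matrix (window analogue of
`inStepM_memMat`). [folklore] -/
theorem inStepMW_memMat (hco : T.CoefOK φ) (hcB : CoefBoxOK φ T coefB) (prec pV : ℕ) {H2 : Array IntervalD} (hH2 : H2.size = T.n)
    {ulo uhi : Dyad} {u : ℝ} (hu0 : 0 ≤ u) (hulo : ulo.toReal ≤ u) (huhi : u ≤ uhi.toReal) (JU : Array Dyad)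
    {ω : ℤ → ℝ} {ωinvB : Array IntervalD} (hω : ∀ i k, -T.Kb ≤ k → k ≤ T.Ka → IntervalD.mem ((ω k)⁻¹) (IntervalD.aget ωinvB (T.idx i k)))
    {A : Fin 4 → ℤ → Fin 4 → ℤ → ℝ}
    (hA : ∀ i' k', -T.Kb ≤ k' → k' ≤ T.Ka → ∀ i k, -T.Kb ≤ k → k ≤ T.Ka →
      ∃ ζ : Fin 4 → ℤ → ℝ, T.InBoxW (T.vecF (IntervalD.loR H2)) (T.vecF (IntervalD.hiR H2)) ζ ∧
        |A i' k' i k - ∑ n ∈ Finset.range (pV + 1), varJet (T.toCertData φ).Qb ζ (basisSt i k) n i' k' * u ^ n|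
          ≤ T.vecF (vre JU) i' k' * (ω k)⁻¹ * u ^ (pV + 1)) :
    MemMat T.n (fun r c => A (T.wi r) (T.wk r) (T.wi c) (T.wk c)) (T.inStepMW coefB prec pV H2 ulo uhi JU ωinvB) := by
  intro r hr c hc
  have hkr := T.InW_wk hr
  have hkc := T.InW_wk hc
  have hm := T.inStepMW_kernel hco hcB prec pV hH2 hu0 hulo huhi JU hω hA (T.wi r) hkr.1 hkr.2 (T.wi c) hkc.1 hkc.2
  rw [T.idx_wi_wk hr, T.idx_wi_wk hc] at hm
  exact hm

end CertTables

end Summit.NavierStokesRegularity.NavierStokesRegularity.Theorems.TaylorModelCert
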